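import Literature.AnabelianGeometry.AbsoluteAnabelian.MLFGaloisDehnTwistTransvections
import HarnessLib

/-!
# `DehnTwistTransvectionsOnUnitsAll ⟹ DehnTwistTransvectionsOnUnits` (one twist pair out of all planes)

PROOF-ONLY companion (abc-iut cell, seat abc-iut-c312-1 gen 9) of the named facts in
`MLFGaloisDehnTwistTransvections.lean` (K. Kondo arXiv:2512.09231 §2, unit-restricted forms): the all-planes fact (one
`ℚ_p`-basis indexed by `Fin c ⊕ Fin g × Fin 2`, `c ≤ 2`, every plane carrying both realised transvections) implies the
one-pair fact consumed by `Summit.ABC.IUTFork.Thm311.Real.exists_mem_ind1StripOf_galoisLog_image_closedBall_ne_of_dehnTwistsOnUnits`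
— since `3 ≤ [k : ℚ_p] = c + 2g` forces `g ≥ 1`, take the plane `i = 0` and re-index the basis by `Fin (c + 2g)`.
So `DehnTwistTransvectionsOnUnitsAll` may serve as the SINGLE master hypothesis of the (Ind1)-strip mover files.  Classical; no
side taken on anything.  [cite: Kondo2025OuterAutMLF, §2 proof of Thm 2.3 p.10]
-/

noncomputable section

namespace Literature.AnabelianGeometry.AbsoluteAnabelian

open Literature.IUT.HodgeArakelov Literature.NumberTheory.GaloisRepresentations ValuativeRel
open scoped ValuativeRel

/-- **All planes ⟹ one pair.** [cite: Kondo2025OuterAutMLF, §2 proof of Thm 2.3 p.10] -/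
theorem dehnTwistTransvectionsOnUnits_of_all (h : DehnTwistTransvectionsOnUnitsAll) :
    DehnTwistTransvectionsOnUnits := by
  intro C p _ hp hp2 hd
  letI : Algebra ℚ_[p] C.k := LocalField.padicAlgebra C.k p hp
  obtain ⟨c, g, hc, y, hall⟩ := h C p hp hp2 hd
  -- `3 ≤ [k : ℚ_p] = c + 2g` and `c ≤ 2` force `g ≥ 1`
  have hcard : Module.finrank ℚ_[p] C.k = c + g * 2 := by
    rw [Module.finrank_eq_card_basis y]
    simp [Fintype.card_sum, Fintype.card_prod, Fintype.card_fin]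
  have hg : 0 < g := by
    by_contra h0
    push Not at h0
    have : g = 0 := Nat.le_zero.mp h0
    rw [hcard, this] at hd
    omega
  obtain ⟨⟨φ, hφ⟩, ⟨φ', hφ'⟩⟩ := hall ⟨0, hg⟩
  -- re-index the basis by `Fin n`
  let e : (Fin c ⊕ Fin g × Fin 2) ≃ Fin (Fintype.card (Fin c ⊕ Fin g × Fin 2)) := Fintype.equivFin _
  refine ⟨_, y.reindex e, e (Sum.inr (⟨0, hg⟩, 0)), e (Sum.inr (⟨0, hg⟩, 1)), ?_, ⟨φ, ?_⟩, ⟨φ', ?_⟩⟩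
  · intro heq
    have := e.injective heq
    simp at this
  · have h1 : ∀ t, (y.reindex e).coord (e (Sum.inr (⟨0, hg⟩, 1))) t = y.coord (Sum.inr (⟨0, hg⟩, 1)) t := fun t => by
      rw [Module.Basis.coord_apply, Module.Basis.repr_reindex_apply, Equiv.symm_apply_apply, Module.Basis.coord_apply]
    have h2 : (y.reindex e) (e (Sum.inr (⟨0, hg⟩, 0))) = y (Sum.inr (⟨0, hg⟩, 0)) := by
      rw [Module.Basis.reindex_apply, Equiv.symm_apply_apply]
    simp_rw [h1, h2]
    exact hφ
  · have h1 : ∀ t, (y.reindex e).coord (e (Sum.inr (⟨0, hg⟩, 0))) t = y.coord (Sum.inr (⟨0, hg⟩, 0)) t := fun t => by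
      rw [Module.Basis.coord_apply, Module.Basis.repr_reindex_apply, Equiv.symm_apply_apply, Module.Basis.coord_apply]
    have h2 : (y.reindex e) (e (Sum.inr (⟨0, hg⟩, 1))) = y (Sum.inr (⟨0, hg⟩, 1)) := by
      rw [Module.Basis.reindex_apply, Equiv.symm_apply_apply]
    simp_rw [h1, h2]
    exact hφ'

end Literature.AnabelianGeometry.AbsoluteAnabelian

end
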